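/-
Copyright (c) 2026 the pub-hodgecm-mathlib formalisation cell (harness21).  Prover seat hodgecm-mathlib-A-p19 (g26): «S3-ram» seeding wave (LEAD F0P3a-plan (g12) T11-41∕T11-52,
owner p06 (g15)), row (e2)(b) «[T2-c]-ram», abstract layer «THE UNIT INDEX OF A LOCAL ORDER IN `𝒪 × 𝒪[√ε]`, `ε` A NON-SQUARE UNIT» (road «S3-tree», crux H413).
-/
import Literature.NumberTheory.Automorphic.QuadraticRamifiedOrderUnitIndex   -- ★ p846518 (this seat): `index_range_units_map_mul_card_eq` (abstract identity), `coord_unique`, `coord_mul`, `natCard_quotient_span_of_coord`, `exists_ringEquiv_quotient_prod_span`, `natCard_quotient_prod_span` (all `θ²`-agnostic)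
import HarnessLib

/-!
# The unit index of a local order in `Λ = 𝒪 × O₁`, `O₁ = 𝒪 ⊕ 𝒪θ`, `θ² = ε` a NON-SQUARE UNIT: `[Λ^× : R^×] · q² = (q² − 1) · [Λ : R]`

Topic `NumberTheory/Automorphic`; namespace `Literature.NumberTheory.Automorphic`.  THEOREMS ONLY (no definition, no instance, no notation, no named fact, no `sorry`); generic
`[Field F] [ValuativeRel F]` currency and an ABSTRACT commutative ring `O₁` with a ring map `j : 𝒪 →+* O₁`, an element `θ` with `θ² = j ε`, `ε` a unit of `𝒪` which is NOT
a square modulo `𝔪` (`∀ b, b² − ε ∈ 𝒪^×`), and unique coordinates `O₁ = j𝒪 ⊕ j𝒪·θ` — the algebraic model of the ring of integers of the UNRAMIFIED quadratic extension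
`K = F(√ε)` of a non-archimedean local field with `2 ∈ 𝒪^×`.  This is the unramified twin of ★ p846518 (`θ² = k ∈ 𝔪`, the RAMIFIED model): there `O₁` has residue field
`𝓀`, here `𝓀(√ε̄)` of size `q²`, so the unit index picks up the factor `(q² − 1)∕q²` instead of `(q − 1)∕q`.
THE MATHEMATICS.  (1) `jb + jcθ ∈ O₁^× ⟺ b ∈ 𝒪^× ∨ c ∈ 𝒪^×` (norm `b² − c²ε`); (2) `O₁` is local with maximal ideal `j(ϖ)·O₁` and `#𝓀_{O₁} = q²` (one bundled existential); (3) `#(O₁⧸ϖ^m)^× =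
(q² − 1)q^{2m−2}`, `#(Λ⧸ϖ^mΛ)^× = (q−1)q^{m−1}·(q²−1)q^{2m−2}`; (4) for a LOCAL subring `R ≤ Λ` with residue field of size `q` containing `ϖ^m Λ` (`m ≥ 1`):
**`[Λ^× : R^×] · q² = (q² − 1) · [Λ : R]`** (★ `index_range_units_map_mul_card_eq` and cancellation).  Consumer: the type-(2) eigen-algebra `L_w × M_{w₁}` at a
TAME-RAMIFIED CM place `w` — by F0P2-p02 (g12)'s sharpening (21:43Z) the eigen-field `M_{w₁} = L_w(√ε)` is then the UNRAMIFIED quadratic extension of `L_w`.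
HONEST LABEL: HC_CM is proved only modulo the 2 remaining named inputs (hLiu418 24832, h413 24833) until rung 0 closes; unconditional commutative algebra, count-neutral.

## References
* [Neukirch1999] J. Neukirch, *Algebraic Number Theory* (1999): Ch. I §12 (orders, conductor, unit index).
* [SerreLocalFields1979] J.-P. Serre, *Local Fields*, GTM 67 (1979): Ch. I §6 Prop. 15–18 (unramified extensions, integral bases).
* [Rogawski1990] J. D. Rogawski, *Automorphic Representations of Unitary Groups in Three Variables* (1990): §4.9 Lemma 4.9.3 p. 56.
-/

set_option autoImplicit false

noncomputable section

open scoped ValuativeRel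

namespace Literature.NumberTheory.Automorphic

open Literature.RingTheory.JacobsonRadical

section Coord

variable {F : Type*} [Field F] [ValuativeRel F] {O₁ : Type*} [CommRing O₁] (j : 𝒪[F] →+* O₁) (θ : O₁) {k : 𝒪[F]}
  (hθ : θ ^ 2 = j k) (hns : ∀ b : 𝒪[F], IsUnit (b * b - k))
  (hcoord : ∀ z : O₁, ∃! bc : 𝒪[F] × 𝒪[F], z = j bc.1 + j bc.2 * θ)

include hθ hns hcoord in
/-- **`jb + jcθ` IS A UNIT IFF `b` OR `c` IS** (`θ² = jε`, `ε̄` a non-square): the norm `b² − c²ε` is a unit as soon as one of `b, c` is (`c` a unit: `c²((b c⁻¹)² − ε)`;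
`c ∈ 𝔪`, `b` a unit: `≡ b²`), and a relation `(jb + jcθ)(jb′ + jc′θ) = 1` forces `bb′ + cc′ε = 1`, impossible for `b, c ∈ 𝔪`. [cite: SerreLocalFields1979, Ch. I §6 Prop. 15] -/
theorem isUnit_add_mul_iff_of_nonsquare (b c : 𝒪[F]) : IsUnit (j b + j c * θ) ↔ IsUnit b ∨ IsUnit c := by
  constructor
  · rintro ⟨u, hu⟩
    obtain ⟨⟨b', c'⟩, hz, -⟩ := hcoord (↑u⁻¹ : O₁)
    have hprod : (j b + j c * θ) * (j b' + j c' * θ) = j 1 + j 0 * θ := by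
      rw [← hu, ← hz, Units.mul_inv, map_one, map_zero, zero_mul, add_zero]
    rw [coord_mul j θ hθ] at hprod
    have h1 := (coord_unique j θ hcoord hprod).1
    by_contra hbc
    push Not at hbc
    have hbm : b ∈ IsLocalRing.maximalIdeal 𝒪[F] := (IsLocalRing.mem_maximalIdeal _).2 hbc.1
    have hcm : c ∈ IsLocalRing.maximalIdeal 𝒪[F] := (IsLocalRing.mem_maximalIdeal _).2 hbc.2
    have hmem : b * b' + c * c' * k ∈ IsLocalRing.maximalIdeal 𝒪[F] :=
      Ideal.add_mem _ (Ideal.mul_mem_right _ _ hbm) (Ideal.mul_mem_right _ _ (Ideal.mul_mem_right _ _ hcm))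
    rw [h1] at hmem
    exact (IsLocalRing.maximalIdeal.isMaximal 𝒪[F]).ne_top (Ideal.eq_top_of_isUnit_mem _ hmem isUnit_one)
  · intro hbc
    have hnu : IsUnit (b * b - c * c * k) := by
      rcases hbc with hb | hc
      · by_cases hc : IsUnit c
        · obtain ⟨ci, hci⟩ := hc.exists_left_inv
          have hfac : b * b - c * c * k = c * c * ((b * ci) * (b * ci) - k) := by
            have : c * ci = 1 := by rw [mul_comm]; exact hci
            calc b * b - c * c * k = b * b * (c * ci) * (c * ci) - c * c * k := by rw [this, mul_one, mul_one]
              _ = c * c * ((b * ci) * (b * ci) - k) := by ring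
          rw [hfac]
          exact (hc.mul hc).mul (hns _)
        · have hcm : c * c * k ∈ IsLocalRing.maximalIdeal 𝒪[F] :=
            Ideal.mul_mem_right _ _ (Ideal.mul_mem_right _ _ ((IsLocalRing.mem_maximalIdeal _).2 hc))
          by_contra hn
          have hn' : b * b - c * c * k ∈ IsLocalRing.maximalIdeal 𝒪[F] := (IsLocalRing.mem_maximalIdeal _).2 hn
          have : b * b ∈ IsLocalRing.maximalIdeal 𝒪[F] := by
            have := Ideal.add_mem _ hn' hcm
            rwa [sub_add_cancel] at this
          rcases (IsLocalRing.maximalIdeal.isMaximal 𝒪[F]).isPrime.mem_or_mem this with h | h <;>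
            exact ((IsLocalRing.mem_maximalIdeal _).1 h) hb
      · obtain ⟨ci, hci⟩ := hc.exists_left_inv
        have hfac : b * b - c * c * k = c * c * ((b * ci) * (b * ci) - k) := by
          have : c * ci = 1 := by rw [mul_comm]; exact hci
          calc b * b - c * c * k = b * b * (c * ci) * (c * ci) - c * c * k := by rw [this, mul_one, mul_one]
            _ = c * c * ((b * ci) * (b * ci) - k) := by ring
        rw [hfac]
        exact (hc.mul hc).mul (hns _)
    obtain ⟨w, hw⟩ := hnu
    refine IsUnit.of_mul_eq_one ((j b + j (-c) * θ) * j (↑w⁻¹ : 𝒪[F])) ?_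
    rw [← mul_assoc, coord_mul j θ hθ]
    have e1 : b * b + c * -c * k = b * b - c * c * k := by ring
    have e2 : b * -c + c * b = 0 := by ring
    rw [e1, e2, map_zero, zero_mul, add_zero, ← map_mul, ← hw, Units.mul_inv, map_one]

include hθ hns hcoord in
/-- **`O₁` IS LOCAL, WITH MAXIMAL IDEAL `j(ϖ)·O₁` AND RESIDUE FIELD OF SIZE `q²`**: the non-units `jb + jcθ` (`b, c ∈ 𝔪 = ϖ𝒪`) are closed under addition and are exactly
`jϖ·(jb′ + jc′θ)`; `#(O₁ ⧸ j(ϖ)O₁) = q²` by ★ `natCard_quotient_span_of_coord` at `m = 1`.  (Bundled as one existential over the `IsLocalRing` instance, which the later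
statements consume by `obtain`.) [cite: SerreLocalFields1979, Ch. I §6 Prop. 15] -/
theorem exists_isLocalRing_maximalIdeal_eq_span_of_nonsquare [Finite 𝓀[F]] {ϖ : F} (hϖ : IsUniformizingElement ϖ) :
    ∃ hO : IsLocalRing O₁, @IsLocalRing.maximalIdeal O₁ _ hO = Ideal.span ({j (⟨ϖ, hϖ.mem⟩ : 𝒪[F])} : Set O₁) ∧
      @Nat.card (@IsLocalRing.ResidueField O₁ _ hO) = Nat.card 𝓀[F] ^ 2 := by
  haveI : Nontrivial O₁ := by
    refine ⟨⟨0, 1, fun h => ?_⟩⟩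
    have h' : j (1 : 𝒪[F]) + j 0 * θ = j 0 + j 0 * θ := by
      simp only [map_one, map_zero, zero_mul, add_zero]; exact h.symm
    exact one_ne_zero (coord_unique j θ hcoord h').1
  have hO : IsLocalRing O₁ := by
    refine IsLocalRing.of_nonunits_add ?_
    intro a b ha hb
    obtain ⟨⟨a₁, a₂⟩, rfl, -⟩ := hcoord a
    obtain ⟨⟨b₁, b₂⟩, rfl, -⟩ := hcoord b
    rw [mem_nonunits_iff, isUnit_add_mul_iff_of_nonsquare j θ hθ hns hcoord] at ha hb
    push Not at ha hb
    rw [mem_nonunits_iff, show j a₁ + j a₂ * θ + (j b₁ + j b₂ * θ) = j (a₁ + b₁) + j (a₂ + b₂) * θ by simp only [map_add]; ring,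
      isUnit_add_mul_iff_of_nonsquare j θ hθ hns hcoord]
    push Not
    constructor
    · intro h
      have := (IsLocalRing.mem_maximalIdeal _).2 ha.1
      have := Ideal.add_mem _ this ((IsLocalRing.mem_maximalIdeal _).2 hb.1)
      exact (IsLocalRing.mem_maximalIdeal _).1 this h
    · intro h
      have := (IsLocalRing.mem_maximalIdeal _).2 ha.2
      have := Ideal.add_mem _ this ((IsLocalRing.mem_maximalIdeal _).2 hb.2)
      exact (IsLocalRing.mem_maximalIdeal _).1 this h
  letI := hO
  set π : 𝒪[F] := ⟨ϖ, hϖ.mem⟩ with hπ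
  have hπmax : π ∈ IsLocalRing.maximalIdeal 𝒪[F] := by
    rw [← hϖ.span_coe_eq_maximalIdeal]; exact Ideal.mem_span_singleton_self _
  have hmax : IsLocalRing.maximalIdeal O₁ = Ideal.span ({j π} : Set O₁) := by
    ext z
    obtain ⟨⟨b, c⟩, rfl, -⟩ := hcoord z
    rw [IsLocalRing.mem_maximalIdeal, mem_nonunits_iff, isUnit_add_mul_iff_of_nonsquare j θ hθ hns hcoord, Ideal.mem_span_singleton']
    push Not
    constructor
    · rintro ⟨hb, hc⟩
      have hb' : b ∈ Ideal.span ({π} : Set 𝒪[F]) := by rw [hπ, hϖ.span_coe_eq_maximalIdeal]; exact (IsLocalRing.mem_maximalIdeal _).2 hb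
      have hc' : c ∈ Ideal.span ({π} : Set 𝒪[F]) := by rw [hπ, hϖ.span_coe_eq_maximalIdeal]; exact (IsLocalRing.mem_maximalIdeal _).2 hc
      rw [Ideal.mem_span_singleton'] at hb' hc'
      obtain ⟨b', rfl⟩ := hb'
      obtain ⟨c', rfl⟩ := hc'
      exact ⟨j b' + j c' * θ, by simp only [map_mul]; ring⟩
    · rintro ⟨a, ha⟩
      obtain ⟨⟨b', c'⟩, rfl, -⟩ := hcoord a
      have hre : (j b' + j c' * θ) * j π = j (b' * π) + j (c' * π) * θ := by simp only [map_mul]; ring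
      rw [hre] at ha
      obtain ⟨h1, h2⟩ := coord_unique j θ hcoord ha
      rw [← h1, ← h2]
      exact ⟨fun h => (IsLocalRing.mem_maximalIdeal _ |>.1 (Ideal.mul_mem_left _ _ hπmax)) h,
        fun h => (IsLocalRing.mem_maximalIdeal _ |>.1 (Ideal.mul_mem_left _ _ hπmax)) h⟩
  refine ⟨hO, hmax, ?_⟩
  unfold IsLocalRing.ResidueField
  rw [hmax]
  have h := natCard_quotient_span_of_coord j θ hcoord hϖ 1
  rw [pow_one, mul_one] at h
  exact h

include hθ hns hcoord in
/-- **`#(O₁ ⧸ ϖ^m O₁)^× = q^{2m−2}(q² − 1)`** for `m ≥ 1` (finite local ring with residue field of size `q²`: ★ `natCard_units_mul_natCard_residueField`).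
[cite: Neukirch1999, Ch. I §12] [cite: SerreLocalFields1979, Ch. I §6 Prop. 18] -/
theorem natCard_units_quotient_span_of_coord_of_nonsquare [Finite 𝓀[F]] {ϖ : F} (hϖ : IsUniformizingElement ϖ) {m : ℕ} (hm : 0 < m) :
    Nat.card (O₁ ⧸ Ideal.span ({j ((⟨ϖ, hϖ.mem⟩ : 𝒪[F]) ^ m)} : Set O₁))ˣ = Nat.card 𝓀[F] ^ (2 * m - 2) * (Nat.card 𝓀[F] ^ 2 - 1) := by
  classical
  obtain ⟨hO, -, hresO⟩ := exists_isLocalRing_maximalIdeal_eq_span_of_nonsquare j θ hθ hns hcoord hϖ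
  letI := hO
  set π : 𝒪[F] := ⟨ϖ, hϖ.mem⟩ with hπ
  set J : Ideal O₁ := Ideal.span ({j (π ^ m)} : Set O₁) with hJ
  have hq : 1 < Nat.card 𝓀[F] := Finite.one_lt_card
  have hcard : Nat.card (O₁ ⧸ J) = Nat.card 𝓀[F] ^ (2 * m) := natCard_quotient_span_of_coord j θ hcoord hϖ m
  haveI : Finite (O₁ ⧸ J) := Nat.finite_of_card_ne_zero (by rw [hcard]; exact pow_ne_zero _ (by omega))
  have hπmax : π ∈ IsLocalRing.maximalIdeal 𝒪[F] := by
    rw [← hϖ.span_coe_eq_maximalIdeal]; exact Ideal.mem_span_singleton_self _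
  have hJtop : J ≠ ⊤ := by
    intro h
    have h1 : (1 : O₁) ∈ J := h ▸ Submodule.mem_top
    rw [hJ, Ideal.mem_span_singleton'] at h1
    obtain ⟨a, ha⟩ := h1
    have hu : IsUnit (j (π ^ m)) := IsUnit.of_mul_eq_one_right a ha
    have hu' : IsUnit (j (π ^ m) + j 0 * θ) := by rwa [map_zero, zero_mul, add_zero]
    rw [isUnit_add_mul_iff_of_nonsquare j θ hθ hns hcoord] at hu'
    rcases hu' with hu' | hu'
    · exact (IsLocalRing.mem_maximalIdeal _ |>.1 (Ideal.pow_mem_of_mem _ hπmax _ hm)) hu'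
    · exact not_isUnit_zero hu'
  haveI : Nontrivial (O₁ ⧸ J) := Ideal.Quotient.nontrivial_iff.2 hJtop
  haveI : IsLocalRing (O₁ ⧸ J) := IsLocalRing.of_surjective' (Ideal.Quotient.mk J) Ideal.Quotient.mk_surjective
  have hres : Nat.card (IsLocalRing.ResidueField (O₁ ⧸ J)) = Nat.card 𝓀[F] ^ 2 := by
    rw [natCard_residueField_quotient_eq J]
    exact hresO
  have key := natCard_units_mul_natCard_residueField (Λ := O₁ ⧸ J)
  rw [hres, hcard] at key
  obtain ⟨m', rfl⟩ := Nat.exists_eq_add_of_le hm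
  have hq2 : 1 ≤ Nat.card 𝓀[F] ^ 2 := Nat.one_le_pow _ _ (by omega)
  have : Nat.card (O₁ ⧸ J)ˣ * Nat.card 𝓀[F] ^ 2 = (Nat.card 𝓀[F] ^ (2 * (1 + m') - 2) * (Nat.card 𝓀[F] ^ 2 - 1)) * Nat.card 𝓀[F] ^ 2 := by
    rw [key]
    have e : 2 * (1 + m') = (2 * (1 + m') - 2) + 2 := by omega
    conv_lhs => rw [e, pow_add]
    ring
  exact Nat.eq_of_mul_eq_mul_right (by positivity) this

end Coord

/-! ## §2 `Λ = 𝒪 × O₁`: the conductor ideal `ϖ^m Λ`, its unit count, and the unit index of a local order -/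

section Prod

variable {F : Type*} [Field F] [ValuativeRel F] {O₁ : Type*} [CommRing O₁] (j : 𝒪[F] →+* O₁) (θ : O₁) {k : 𝒪[F]}
  (hθ : θ ^ 2 = j k) (hns : ∀ b : 𝒪[F], IsUnit (b * b - k))
  (hcoord : ∀ z : O₁, ∃! bc : 𝒪[F] × 𝒪[F], z = j bc.1 + j bc.2 * θ)

include hθ hns hcoord in
/-- **`#(Λ ⧸ ϖ^m Λ)^× = (q^{m−1}(q−1)) · (q^{2m−2}(q²−1))`** for `Λ = 𝒪 × O₁`, `m ≥ 1`. [cite: Neukirch1999, Ch. I §12] [cite: SerreLocalFields1979, Ch. I §6 Prop. 18] -/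
theorem natCard_units_quotient_prod_span_of_nonsquare [Finite 𝓀[F]] {ϖ : F} (hϖ : IsUniformizingElement ϖ) {m : ℕ} (hm : 0 < m) :
    Nat.card ((𝒪[F] × O₁) ⧸ Ideal.span ({(((⟨ϖ, hϖ.mem⟩ : 𝒪[F]) ^ m, j ((⟨ϖ, hϖ.mem⟩ : 𝒪[F]) ^ m)) : 𝒪[F] × O₁)} : Set (𝒪[F] × O₁)))ˣ =
      (Nat.card 𝓀[F] ^ (m - 1) * (Nat.card 𝓀[F] - 1)) * (Nat.card 𝓀[F] ^ (2 * m - 2) * (Nat.card 𝓀[F] ^ 2 - 1)) := by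
  obtain ⟨e⟩ := exists_ringEquiv_quotient_prod_span j ((⟨ϖ, hϖ.mem⟩ : 𝒪[F]) ^ m)
  rw [Nat.card_congr (Units.mapEquiv e.toMulEquiv).toEquiv, Nat.card_congr (MulEquiv.prodUnits).toEquiv, Nat.card_prod,
    natCard_units_quotient_span_uniformizer_pow hϖ hm, natCard_units_quotient_span_of_coord_of_nonsquare j θ hθ hns hcoord hϖ hm]

include hθ hns hcoord in
/-- **THE UNIT INDEX OF A LOCAL ORDER IN `𝒪 × 𝒪[√ε]`, `ε` A NON-SQUARE UNIT.**  `Λ = 𝒪 × O₁` (`O₁ = j𝒪 ⊕ j𝒪θ`, `θ² = jε`; `𝒪` a DVR with residue field of size `q`), `R ≤ Λ` a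
LOCAL subring whose residue field has `q` elements and which contains `ϖ^m Λ` for some `m ≥ 1`.  Then **`[Λ^× : R^×] · q² = (q² − 1) · [Λ : R]`**: ★ `index_range_units_map_mul_card_eq`
with `#(Λ⧸ϖ^mΛ) = q^{3m}`, `#(Λ⧸ϖ^mΛ)^× = (q−1)q^{m−1}·(q²−1)q^{2m−2}` and cancellation of `(q−1) q^{3m−2}`.  (Unramified twin of ★ `index_range_units_map_prod_mul_eq`.)
[cite: Neukirch1999, Ch. I §12] [cite: Rogawski1990, §4.9 Lemma 4.9.3 p. 56] -/
theorem index_range_units_map_prod_mul_sq_eq [Finite 𝓀[F]] {ϖ : F} (hϖ : IsUniformizingElement ϖ) {m : ℕ} (hm : 0 < m)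
    (R : Subring (𝒪[F] × O₁)) [IsLocalRing R] (hres : Nat.card (IsLocalRing.ResidueField R) = Nat.card 𝓀[F])
    (hcond : ∀ x : 𝒪[F] × O₁, (((⟨ϖ, hϖ.mem⟩ : 𝒪[F]) ^ m, j ((⟨ϖ, hϖ.mem⟩ : 𝒪[F]) ^ m)) : 𝒪[F] × O₁) * x ∈ R) :
    (Units.map (R.subtype : R →* 𝒪[F] × O₁)).range.index * Nat.card 𝓀[F] ^ 2 = (Nat.card 𝓀[F] ^ 2 - 1) * R.toAddSubgroup.index := by
  classical
  set π : 𝒪[F] := ⟨ϖ, hϖ.mem⟩ with hπ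
  set 𝔣 : Ideal (𝒪[F] × O₁) := Ideal.span ({((π ^ m, j (π ^ m)) : 𝒪[F] × O₁)} : Set (𝒪[F] × O₁)) with h𝔣
  have hq : 1 < Nat.card 𝓀[F] := Finite.one_lt_card
  have h𝔣R : (𝔣 : Set (𝒪[F] × O₁)) ⊆ R := by
    intro x hx
    rw [SetLike.mem_coe, h𝔣, Ideal.mem_span_singleton'] at hx
    obtain ⟨a, rfl⟩ := hx
    rw [mul_comm]; exact hcond a
  -- `ϖ^m Λ ⊆ rad Λ`: componentwise `1 + ϖ^m(…)` is a unit (in `O₁` because `jϖ^m` lies in the maximal ideal `j(ϖ)O₁`)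
  have h𝔣J : 𝔣 ≤ Ideal.jacobson ⊥ := by
    obtain ⟨hO, -, -⟩ := exists_isLocalRing_maximalIdeal_eq_span_of_nonsquare j θ hθ hns hcoord hϖ
    letI := hO
    have hπmax : π ∈ IsLocalRing.maximalIdeal 𝒪[F] := by
      rw [← hϖ.span_coe_eq_maximalIdeal]; exact Ideal.mem_span_singleton_self _
    have hπm : π ^ m ∈ IsLocalRing.maximalIdeal 𝒪[F] := Ideal.pow_mem_of_mem _ hπmax _ hm
    have hjm : j (π ^ m) ∈ IsLocalRing.maximalIdeal O₁ := by
      rw [IsLocalRing.mem_maximalIdeal, mem_nonunits_iff]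
      have : ¬ IsUnit (j (π ^ m) + j 0 * θ) := by
        rw [isUnit_add_mul_iff_of_nonsquare j θ hθ hns hcoord]
        push Not
        exact ⟨(IsLocalRing.mem_maximalIdeal _).1 hπm, not_isUnit_zero⟩
      rwa [map_zero, zero_mul, add_zero] at this
    rw [h𝔣, Ideal.span_le]
    intro x hx
    rw [Set.mem_singleton_iff] at hx
    subst hx
    rw [SetLike.mem_coe, Ideal.mem_jacobson_bot]
    rintro ⟨y₁, y₂⟩
    rw [Prod.mk_mul_mk, Prod.mk_add_mk, Prod.isUnit_iff]
    constructor
    · have h1 : π ^ m * y₁ ∈ IsLocalRing.maximalIdeal 𝒪[F] := Ideal.mul_mem_right _ _ hπm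
      rw [← IsLocalRing.jacobson_eq_maximalIdeal ⊥ bot_ne_top, Ideal.mem_jacobson_bot] at h1
      simpa using h1 1
    · have h2 : j (π ^ m) * y₂ ∈ IsLocalRing.maximalIdeal O₁ := Ideal.mul_mem_right _ _ hjm
      rw [← IsLocalRing.jacobson_eq_maximalIdeal ⊥ bot_ne_top, Ideal.mem_jacobson_bot] at h2
      simpa using h2 1
  have hcard : Nat.card ((𝒪[F] × O₁) ⧸ 𝔣) = Nat.card 𝓀[F] ^ (3 * m) := natCard_quotient_prod_span j θ hcoord hϖ m
  have hunits : Nat.card ((𝒪[F] × O₁) ⧸ 𝔣)ˣ = (Nat.card 𝓀[F] ^ (m - 1) * (Nat.card 𝓀[F] - 1)) * (Nat.card 𝓀[F] ^ (2 * m - 2) * (Nat.card 𝓀[F] ^ 2 - 1)) :=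
    natCard_units_quotient_prod_span_of_nonsquare j θ hθ hns hcoord hϖ hm
  haveI : Finite ((𝒪[F] × O₁) ⧸ 𝔣) := Nat.finite_of_card_ne_zero (by rw [hcard]; exact pow_ne_zero _ (by omega))
  have hπmax : π ∈ IsLocalRing.maximalIdeal 𝒪[F] := by
    rw [← hϖ.span_coe_eq_maximalIdeal]; exact Ideal.mem_span_singleton_self _
  have h𝔣top : Ideal.comap R.subtype 𝔣 ≠ ⊤ := by
    intro htop
    have h1 : (1 : R) ∈ Ideal.comap R.subtype 𝔣 := htop ▸ Submodule.mem_top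
    rw [Ideal.mem_comap, map_one, h𝔣, Ideal.mem_span_singleton'] at h1
    obtain ⟨⟨a, b⟩, hab⟩ := h1
    rw [Prod.mk_mul_mk, Prod.mk_eq_one] at hab
    have hu : IsUnit (π ^ m) := IsUnit.of_mul_eq_one_right a hab.1
    exact (IsLocalRing.mem_maximalIdeal _ |>.1 (Ideal.pow_mem_of_mem _ hπmax _ hm)) hu
  have key := index_range_units_map_mul_card_eq R 𝔣 h𝔣R h𝔣J h𝔣top
  rw [hres, hcard, hunits] at key
  -- cancel `(q - 1) q^{3m-2}`
  obtain ⟨m', rfl⟩ := Nat.exists_eq_add_of_le hm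
  obtain ⟨p, hp⟩ : ∃ p, Nat.card 𝓀[F] = p + 1 := ⟨Nat.card 𝓀[F] - 1, by omega⟩
  set U := (Units.map (R.subtype : R →* 𝒪[F] × O₁)).range.index
  set I := R.toAddSubgroup.index
  rw [hp] at key ⊢
  simp only [Nat.add_sub_cancel, Nat.add_sub_cancel_left] at key ⊢
  have e1 : 2 * (1 + m') - 2 = 2 * m' := by omega
  rw [e1] at key
  have e2 : (p + 1) ^ 2 - 1 = p * (p + 2) := by
    have : (p + 1) ^ 2 = p * (p + 2) + 1 := by ring
    omega
  rw [e2] at key ⊢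
  have hp0 : 0 < p := by omega
  have hpos : 0 < p * (p + 1) ^ (3 * m' + 1) := Nat.mul_pos hp0 (pow_pos (Nat.succ_pos p) _)
  refine Nat.eq_of_mul_eq_mul_right hpos ?_
  have lhs : U * (p + 1) ^ 2 * (p * (p + 1) ^ (3 * m' + 1)) = U * (p + 1) ^ (3 * (1 + m')) * p := by ring
  rw [lhs, key]
  ring

end Prod

end Literature.NumberTheory.Automorphic

end
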